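import Summits.BirchSwinnertonDyer.Rank1Residual.X11b.AnticyclotomicLocalTowerTorsion
import Summits.BirchSwinnertonDyer.Rank1Residual.X11b.AnticyclotomicEmbedding
import Summits.BirchSwinnertonDyer.Rank1Residual.X11b.CastellaErratum
import Literature.NumberTheory.EllipticCurves.StrictSelmerRankOne
import HarnessLib

/-!
# X11b, route R1 — the erratum's literal (iv) `E(ℚ_p)[p] = 0` ⟹ `E(K_𝔭)[p] = 0` ⟹
# `E(K̄)[p^∞]^{D_𝔭}[p] = 0` ⟹ `E(K_{∞,w})[p^∞] = 0` at a degree-one `𝔭 ∣ p` (Galois descent)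

HONEST FRAMING (cell `b2b-bsdres`, run/shared/lean/b2b/bsd-rank1-residual/, verbatim in every
file): the goal of the cell is to DELETE the COMBINATION-SHAPED residual classes of the
Birch–Swinnerton-Dyer formula for ALL analytic-rank `≤ 1` elliptic curves over `ℚ` — "full BSD
formula for every rank `≤ 1` curve in class `C`" assembled STRICTLY from published theorems — so
that the rank-`≤ 1` remainder becomes exactly the CONSTRUCTION-SHAPED classes, which are TYPED
(missing-input `Prop`s), NOT attempted. This is not "finishing BSD". Sub-cell
`b2b-bsdres-multr1-p1` (X11b, route R1 = Castella 2018 Thm. A re-proved along the author's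
erratum); a RESEARCH ROUTE; no claim beyond the stated class; X11b stays CONSTRUCTION-SHAPED;
nothing here changes a label; no named fact is minted (proved theorems only; no `sorry`).

## Why this file

`AnticyclotomicLocalTowerTorsion` (this gen) proved, on the tree's Galois modules, the local
analogue of the erratum's Lemma 2.1 (glob): `E(K_{∞,w})[p^∞] = 0` above `𝔭` for EVERY
`ℤ_p`-extension, from the hypothesis "the `D_𝔭`-fixed points of `E(K̄)[p^∞]` have no `p`-torsion"
(`fixedPoints_decomp_inf_kerSubgroup_eq_bot`). The erratum states hypothesis (iv) LITERALLY as
"`E(ℚ_p)[p] = 0`", transcribed by the cell (x11b, `X11.AprimeLocusAt`) as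
`∀ P : (W.baseChange ℚ_[p]).toAffine.Point, p • P = 0 → P = 0`. This bookkeeping file closes the
gap between the two forms at the data of route R1's typed inputs (`R1ControlOnTreeAt`,
`R1OpenInputOnTreeAt`: an erratum field `K`, `p = 𝔭𝔭̄` split, `𝔭` of degree one):

* `noPTorsion_baseChange_adicCompletion_of_padic` — a ring map `K_𝔭 → ℚ_p` (it exists iff `𝔭` has
  degree one; `exists_ringHom_adicCompletion_padic_of_degreeOne`, the tree's
  `adicCompletionEquivOfDegreeOne` composed with Mathlib's `Padic.adicCompletionEquiv`, as in gen 8's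
  `embAt`) transports "`E(ℚ_p)[p] = 0`" to "`E(K_𝔭)[p] = 0`" (`(W_K)_{K_𝔭} = W_{K_𝔭}`,
  `WeierstrassCurve.map_baseChange`; Mathlib's injective `Affine.Point.map`);
* `eq_zero_of_fixed_decomp_of_local` — **Galois descent**: a point of `E(K̄)[p^∞]` fixed by the
  decomposition group `D_𝔭 = decomp 𝔭` (the image of `Γ_{K_𝔭}` for the chosen embedding
  `ι₀ : K̄ → K̄_𝔭`) maps under `ι₀` to a `Γ_{K_𝔭}`-fixed point of `E(K̄_𝔭)` (`pointsMapOfEmb_smul`),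
  which comes from `E(K_𝔭)` (tree `exists_map_eq_of_forall_smul_localPoints_eq`, Silverman I.§1 /
  VIII.§1); so "`E(K_𝔭)[p] = 0`" gives "`E(K̄)[p^∞]^{D_𝔭}[p] = 0`";
* **`fixedPoints_decomp_inf_kerSubgroup_eq_bot_of_aprimeLocusAt`** / **`ErratumHypotheses.…`** /
  **`ChainLocus.…`**: on the A′-locus (hence on route R1's population), for EVERY number field `K`,
  EVERY degree-one prime `𝔭 ∣ p` of `K` and EVERY `ℤ_p`-extension `κ` of `K`:
  `E(K̄)[p^∞]^{D_𝔭 ⊓ ker κ} = 0` — hypothesis (iv) consumed at exactly the data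
  `(K, κ, 𝔭, h𝔭, he, hf)` over which `R1ControlOnTreeAt` / `R1OpenInputOnTreeAt` quantify.

What is NOT claimed: anything at primes `𝔭` of degree `> 1` (there `E(K_𝔭)[p] = 0` is a stronger
condition than (iv)); any control / congruence statement.

References: [Castella2018Erratum] Thm. 1.1 (iv), Thm. A′, Remark (2), Lemma 2.1 (pp. 1–2);
[SilvermanAEC2009] I.§1, VIII.§1 (Galois descent for points); [Castella2018] §2.2 ("`K_𝔭 = ℚ_p`").
-/

noncomputable section

open scoped Classical

open NumberField IsDedekindDomain Field
open Literature.NumberTheory.EllipticCurves Literature.NumberTheory.EllipticCurves.GreenbergSelmer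
open Literature.NumberTheory.GaloisRepresentations Literature.NumberTheory.Automorphic

universe u

namespace Summit.BirchSwinnertonDyer.Rank1Residual.X11b.AcSelmer

/-! ## `E(ℚ_p)[p] = 0 ⟹ E(K_𝔭)[p] = 0` along a ring map `K_𝔭 → ℚ_p` -/

section Transport

variable (W : WeierstrassCurve ℚ) (p : ℕ) [Fact p.Prime] {K : Type} [Field K] [NumberField K]

/-- **`E(ℚ_p)[p] = 0 ⟹ E(K_𝔭)[p] = 0`** when `K_𝔭` maps into `ℚ_p` (a ring map of fields is
injective; points of `W` over `K_𝔭` map injectively to points over `ℚ_p`, Mathlib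
`Affine.Point.map_injective`; `(W_K)_{K_𝔭} = W_{K_𝔭}` by `WeierstrassCurve.map_baseChange`).
[cite: Castella2018Erratum, Thm. 1.1 (iv) (p. 1)] [cite: Castella2018, §2.2 (arXiv:1704.06608 p. 5), "`K_𝔭 = ℚ_p`"] -/
theorem noPTorsion_baseChange_adicCompletion_of_padic (𝔭 : HeightOneSpectrum (𝓞 K))
    (e : 𝔭.adicCompletion K →+* ℚ_[p])
    (h4 : ∀ P : (W.baseChange ℚ_[p]).toAffine.Point, p • P = 0 → P = 0) :
    ∀ R : ((W.baseChange K).baseChange (𝔭.adicCompletion K)).toAffine.Point, p • R = 0 → R = 0 := by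
  have hW : (W.baseChange K).baseChange (𝔭.adicCompletion K) = W.baseChange (𝔭.adicCompletion K) :=
    W.map_baseChange (algebraMap K (𝔭.adicCompletion K)).toRatAlgHom
  rw [hW]
  intro R hR
  have hmap := h4 (WeierstrassCurve.Affine.Point.map e.toRatAlgHom R) (by rw [← map_nsmul, hR, map_zero])
  exact WeierstrassCurve.Affine.Point.map_injective (W' := W) e.toRatAlgHom
    (by rw [hmap, map_zero])

/-- **At a degree-one prime `𝔭 ∣ p` there is a ring map `K_𝔭 → ℚ_p`** (indeed `K_𝔭 ≃ ℚ_v ≃ ℚ_p`: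
the tree's `adicCompletionEquivOfDegreeOne` and Mathlib's `Padic.adicCompletionEquiv`, the two
isomorphisms behind gen 8's `embAt`). [cite: FrohlichTaylor1990, Ch. III §1 (1.14)(a)] -/
theorem exists_ringHom_adicCompletion_padic_of_degreeOne (𝔭 : HeightOneSpectrum (𝓞 K))
    (h𝔭 : ((p : ℕ) : 𝓞 K) ∈ 𝔭.asIdeal) (he : 𝔭.asIdeal.ramificationIdx (𝓞 ℚ) = 1)
    (hf : 𝔭.asIdeal.inertiaDeg (𝓞 ℚ) = 1) : Nonempty (𝔭.adicCompletion K →+* ℚ_[p]) :=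
  haveI : 𝔭.asIdeal.LiesOver (ratPlace p).asIdeal := ⟨by rw [← under_eq_ratPlace_of_mem h𝔭]; rfl⟩
  ⟨(Padic.adicCompletionEquiv (𝓞 ℚ) ⟨p, Fact.out⟩).symm.toAlgEquiv.toRingEquiv.toRingHom.comp
    (adicCompletionEquivOfDegreeOne ℚ K (ratPlace p) 𝔭 he hf).symm.toRingHom⟩

end Transport

/-! ## Galois descent: `E(K_𝔭)[p] = 0 ⟹` the `D_𝔭`-fixed points of `E(K̄)[p^∞]` have no `p`-torsion -/

section Descent

variable {K : Type u} [Field K] [NumberField K] (W : WeierstrassCurve K) (p : ℕ)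

/-- **Galois descent at `𝔭`.** If `E(K_𝔭)[p] = 0` (no nonzero `K_𝔭`-point of `W` killed by `p`),
then a point `m ∈ E(K̄)[p^∞]` fixed by the decomposition group `D_𝔭 = decomp 𝔭` with `p m = 0` is
`0`: its image `ι₀(m) ∈ E(K̄_𝔭)` along the chosen embedding `ι₀ : K̄ → K̄_𝔭` is fixed by `Γ_{K_𝔭}`
(`D_𝔭` is the image of `Γ_{K_𝔭}`, `pointsMapOfEmb_smul`), hence comes from a point `R ∈ E(K_𝔭)`
(tree `exists_map_eq_of_forall_smul_localPoints_eq`), and `p R = 0` by injectivity of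
`E(K_𝔭) → E(K̄_𝔭)`; so `R = 0`, `ι₀(m) = 0`, `m = 0`. [cite: SilvermanAEC2009, I.§1 and VIII.§1 (proof of Prop. 1.2)] -/
theorem eq_zero_of_fixed_decomp_of_local (𝔭 : HeightOneSpectrum (𝓞 K))
    (hKv : ∀ R : (W.baseChange (𝔭.adicCompletion K)).toAffine.Point, p • R = 0 → R = 0)
    (m : W.geomPrimaryTorsion p) (hfix : ∀ d ∈ decomp 𝔭, d • m = m) (hpm : p • m = 0) : m = 0 := by
  set ι₀ := closureEmb (K := K) (𝔭.adicCompletion K) with hι₀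
  set X : localPoints W (𝔭.adicCompletion K) := pointsMapOfEmb W ι₀ (m : W.geomPoints) with hX
  -- `X` is fixed by `Γ_{K_𝔭}`
  have hXfix : ∀ τ : absoluteGaloisGroup (𝔭.adicCompletion K), τ • X = X := fun τ ↦ by
    have hmem : resGalOfEmb ι₀ τ ∈ decomp 𝔭 := (mem_decomp_iff 𝔭 _).mpr ⟨τ, rfl⟩
    have h : resGalOfEmb ι₀ τ • (m : W.geomPoints) = m :=
      congrArg (fun x : W.geomPrimaryTorsion p ↦ (x : W.geomPoints)) (hfix _ hmem)
    rw [hX, ← pointsMapOfEmb_smul, h]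
  -- descent to `E(K_𝔭)` (`K_𝔭` has characteristic `0`, hence is perfect)
  haveI : CharZero (𝔭.adicCompletion K) :=
    charZero_of_injective_algebraMap (algebraMap K (𝔭.adicCompletion K)).injective
  obtain ⟨R, hR⟩ := exists_map_eq_of_forall_smul_localPoints_eq W (𝔭.adicCompletion K) hXfix
  have hinj := WeierstrassCurve.Affine.Point.map_injective (W' := W)
    (IsScalarTower.toAlgHom K (𝔭.adicCompletion K) (AlgebraicClosure (𝔭.adicCompletion K)))
  have hpX : p • X = 0 := by
    have h1 : pointsMapOfEmb W ι₀ ((p • m : W.geomPrimaryTorsion p) : W.geomPoints) = p • X := by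
      rw [AddSubgroupClass.coe_nsmul, (pointsMapOfEmb W ι₀).map_nsmul]
    rw [← h1, hpm, ZeroMemClass.coe_zero, (pointsMapOfEmb W ι₀).map_zero]
  have hpR : p • R = 0 := by
    apply hinj
    rw [map_nsmul, hR, map_zero]
    exact hpX
  have hR0 : R = 0 := hKv R hpR
  have hX0 : X = 0 := by rw [← hR, hR0]; exact map_zero _
  have hm0 : (m : W.geomPoints) = 0 :=
    pointsMapOfEmb_injective W ι₀ (by rw [(pointsMapOfEmb W ι₀).map_zero, ← hX]; exact hX0)
  exact Subtype.ext (by rw [hm0]; rfl)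

end Descent

end Summit.BirchSwinnertonDyer.Rank1Residual.X11b.AcSelmer

/-! ## Route R1: (iv) ⟹ `E(K_{∞,w})[p^∞] = 0` at every degree-one `𝔭 ∣ p`, every `ℤ_p`-extension -/

namespace Summit.BirchSwinnertonDyer.Rank1Residual.X11b

section RouteR1

open AcSelmer Literature.NumberTheory.EllipticCurves.Rank1Residual
  Literature.NumberTheory.EllipticCurves.Rank1Residual.Typed

variable (W : WeierstrassCurve ℚ) [W.IsElliptic] [W.IsGloballyMinimal] (p : ℕ) [Fact p.Prime]

/-- **On the A′-locus, hypothesis (iv) `E(ℚ_p)[p] = 0` gives `E(K_{∞,w})[p^∞] = 0`** for EVERY number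
field `K`, EVERY prime `𝔭 ∣ p` of `K` of degree one (`e = f = 1`, so `K_𝔭 ≃ ℚ_p`), EVERY
`ℤ_p`-extension `κ` of `K` and the place `w` of `K_∞` above `𝔭` of the chosen embedding:
`E(K̄)[p^∞]^{D_𝔭 ⊓ ker κ} = 0`. Chain: (iv) ⟹ `E(K_𝔭)[p] = 0` (transport along `K_𝔭 ≃ ℚ_p`) ⟹
`E(K̄)[p^∞]^{D_𝔭}[p] = 0` (Galois descent) ⟹ `E(K̄)[p^∞]^{D_𝔭 ⊓ ker κ} = 0` (pro-`p` descent,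
`fixedPoints_decomp_inf_kerSubgroup_eq_bot`). These are exactly the data `(K, κ, 𝔭, h𝔭, he, hf)` of
`R1ControlOnTreeAt` / `R1OpenInputOnTreeAt`. [cite: Castella2018Erratum, Thm. A′ hypothesis "`E(ℚ_p)[p] = 0`", Thm. 1.1 (iv), Remark (2), Lemma 2.1 (pp. 1–2)] -/
theorem fixedPoints_decomp_inf_kerSubgroup_eq_bot_of_aprimeLocusAt (hloc : X11.AprimeLocusAt W p)
    (K : Type) [Field K] [NumberField K] (κ : ZpExtension K p) (𝔭 : HeightOneSpectrum (𝓞 K))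
    (h𝔭 : ((p : ℕ) : 𝓞 K) ∈ 𝔭.asIdeal) (he : 𝔭.asIdeal.ramificationIdx (𝓞 ℚ) = 1)
    (hf : 𝔭.asIdeal.inertiaDeg (𝓞 ℚ) = 1) :
    FixedPoints.addSubgroup ↥(decomp 𝔭 ⊓ κ.kerSubgroup) ((W.baseChange K).geomPrimaryTorsion p) = ⊥ := by
  obtain ⟨e⟩ := exists_ringHom_adicCompletion_padic_of_degreeOne p 𝔭 h𝔭 he hf
  have hKv := noPTorsion_baseChange_adicCompletion_of_padic W p 𝔭 e hloc.2
  have hW : (W.baseChange K).baseChange (𝔭.adicCompletion K) = W.baseChange (𝔭.adicCompletion K) :=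
    W.map_baseChange (algebraMap K (𝔭.adicCompletion K)).toRatAlgHom
  refine fixedPoints_decomp_inf_kerSubgroup_eq_bot κ (W.baseChange K) 𝔭 fun m hfix hpm ↦
    eq_zero_of_fixed_decomp_of_local (W.baseChange K) p 𝔭 ?_ m hfix hpm
  exact hKv

variable {W p}

/-- **On the A′-hypotheses** (`ErratumHypotheses`): `E(K̄)[p^∞]^{D_𝔭 ⊓ ker κ} = 0` at every degree-one
`𝔭 ∣ p` of every number field, every `ℤ_p`-extension. [cite: Castella2018Erratum, Thm. 1.1 (iv) and Lemma 2.1 (pp. 1–2)] -/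
theorem ErratumHypotheses.fixedPoints_decomp_inf_kerSubgroup_eq_bot (h : ErratumHypotheses W p)
    (K : Type) [Field K] [NumberField K] (κ : ZpExtension K p) (𝔭 : HeightOneSpectrum (𝓞 K))
    (h𝔭 : ((p : ℕ) : 𝓞 K) ∈ 𝔭.asIdeal) (he : 𝔭.asIdeal.ramificationIdx (𝓞 ℚ) = 1)
    (hf : 𝔭.asIdeal.inertiaDeg (𝓞 ℚ) = 1) :
    FixedPoints.addSubgroup ↥(decomp 𝔭 ⊓ κ.kerSubgroup) ((W.baseChange K).geomPrimaryTorsion p) = ⊥ :=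
  fixedPoints_decomp_inf_kerSubgroup_eq_bot_of_aprimeLocusAt W p h.2.2.2 K κ 𝔭 h𝔭 he hf

/-- **On route R1's population (`ChainLocus`)**: `E(K̄)[p^∞]^{D_𝔭 ⊓ ker κ} = 0` at every degree-one
`𝔭 ∣ p` of every number field `K` (in particular the two primes `𝔭, 𝔭̄` of an erratum field, where
`p ∣ N_E` splits), for every `ℤ_p`-extension `κ` (in particular the anticyclotomic one).
[cite: Castella2018Erratum, Thm. A′ (p. 1), Thm. 1.1 (iv), Lemma 2.1 (p. 2)] -/
theorem ChainLocus.fixedPoints_decomp_inf_kerSubgroup_eq_bot (h : ChainLocus W p)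
    (K : Type) [Field K] [NumberField K] (κ : ZpExtension K p) (𝔭 : HeightOneSpectrum (𝓞 K))
    (h𝔭 : ((p : ℕ) : 𝓞 K) ∈ 𝔭.asIdeal) (he : 𝔭.asIdeal.ramificationIdx (𝓞 ℚ) = 1)
    (hf : 𝔭.asIdeal.inertiaDeg (𝓞 ℚ) = 1) :
    FixedPoints.addSubgroup ↥(decomp 𝔭 ⊓ κ.kerSubgroup) ((W.baseChange K).geomPrimaryTorsion p) = ⊥ :=
  h.erratumHypotheses.fixedPoints_decomp_inf_kerSubgroup_eq_bot K κ 𝔭 h𝔭 he hf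

/-- **Split primes of a quadratic field**: on `ChainLocus`, for `[K : ℚ] = 2` with `p` split in `K`
(`SplitsIn K p`, e.g. an erratum field: `p ∣ N_E` and every prime of `N_E` splits), EVERY prime
`𝔭 ∋ p` has degree one (`degreeOne_of_splitsIn`), so `E(K̄)[p^∞]^{D_𝔭 ⊓ ker κ} = 0` for every `κ`.
[cite: Castella2018Erratum, Thm. 1.1 (iv) and Lemma 2.1 (pp. 1–2)] -/
theorem ChainLocus.fixedPoints_decomp_inf_kerSubgroup_eq_bot_of_splitsIn (h : ChainLocus W p)
    (K : Type) [Field K] [NumberField K] (h2 : Module.finrank ℚ K = 2) (hs : SplitsIn K p)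
    (κ : ZpExtension K p) (𝔭 : HeightOneSpectrum (𝓞 K)) (h𝔭 : ((p : ℕ) : 𝓞 K) ∈ 𝔭.asIdeal) :
    FixedPoints.addSubgroup ↥(decomp 𝔭 ⊓ κ.kerSubgroup) ((W.baseChange K).geomPrimaryTorsion p) = ⊥ :=
  h.fixedPoints_decomp_inf_kerSubgroup_eq_bot K κ 𝔭 h𝔭 (degreeOne_of_splitsIn h2 hs h𝔭).1
    (degreeOne_of_splitsIn h2 hs h𝔭).2

end RouteR1

end Summit.BirchSwinnertonDyer.Rank1Residual.X11b

end
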